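import Mathlib.LinearAlgebra.FiniteDimensional.Lemmas
import Mathlib.LinearAlgebra.Quotient.Basic
import Mathlib.LinearAlgebra.Prod
import HarnessLib

/-!
# Venture HSemireg — the block-rank formulas of the E₃ and E₄ pages: `rank(ker A → Y ⧸ range C) =
# rank [[A, B], [0, C]] − rank A − rank C` and its three-weight analogue

HONEST FRAMING. Pure finite-dimensional linear algebra over a division ring; no variety, sheaf or spectral sequence
is constructed here and nothing here says that HC, HC_CM or HC_AV holds. This is the identity by which the cell's two
E₃-page codes (t-26 `e3page.py` «FAST PATH», E3PAGE-t26g13 §1 (vi); t-8 `e3x2.py`) turn the rank of the induced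
differential `d₂ : E₂^{t,q} → E₂^{t+1,q−1}` of a weight-filtered complex `(C, D₀ + D₁ + …)` into three sparse ranks:
with `A = D₀|_{C^t_q}`, `B = D₁|_{C^t_q}`, `C = D₀|_{C^t_{q−1}}` (so that `d₂` is the map induced by `B` from the
`D₀`-cocycles `ker A` to the quotient `Y ⧸ range C` of the target weight block),
`rank d₂ = rank [[A, B], [0, C]] − rank A − rank C`. The codes checked it numerically against explicit cocycle
kernels on every small design; here it is a theorem.

CONTENT. For linear maps `A : U → X`, `B : U → Y`, `C : W → Y` with `U`, `W` finite-dimensional, writing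
`M = [[A, B], [0, C]] : U × W → X × Y`, `(u, w) ↦ (A u, B u + C w)` and `ι : ker A → Y ⧸ range C`, `u ↦ [B u]`:
* `finrank_range_kerInduced_add_eq_finrank_range_block` —
  `finrank (range ι) + finrank (range A) + finrank (range C) = finrank (range M)`.
Proof: rank–nullity for `M`, `A`, `C`, `ι` and for the projection `φ : ker M → ker A`, whose range is `ker ι` and
whose kernel is the injective image of `ker C` under `w ↦ (0, w)`.
* `finrank_range_kerPairInduced_add_eq` — the next page: for six maps `A, B, G, A', B', A''` (three consecutive
  weights: `A, A', A''` the `D₀` blocks, `B, B'` the `D₁` blocks, `G` the `D₂` block), with `M₂ = [[A,B],[0,A']]`,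
  `M₂' = [[A',B'],[0,A'']]`, `N = [[A,B,G],[0,A',B'],[0,0,A'']]` and `d : ker M₂ → W₃ ⧸ (range A'' + B'(ker A'))`,
  `(x,y) ↦ [G x + B' y]` (the third differential read on corrected representatives `x + y`):
  `rank d + rank M₂ + rank M₂' = rank N + rank A'` — the cell's E₄-page formula
  «rank d₃ = rk M₃ − rk M₂(q) − rk M₂(q−1) + rk D₀|_{q−1}» (KAPPA-RANDC-E4-t26g14 §4, there derived on paper and
  unit-tested on random filtered complexes). No relation among the maps (such as `D² = 0`) is needed for either
  identity.
-/

namespace Summit.Ventures.HSemireg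

open Module LinearMap Submodule

variable {K : Type*} [DivisionRing K]
variable {U W X Y : Type*} [AddCommGroup U] [Module K U] [AddCommGroup W] [Module K W]
  [AddCommGroup X] [Module K X] [AddCommGroup Y] [Module K Y]

/-- **The block-rank formula of the page differential.** For `A : U → X`, `B : U → Y`, `C : W → Y` over a division
ring with `U`, `W` finite-dimensional, the map `ker A → Y ⧸ range C` induced by `B` satisfies
`rank + rank A + rank C = rank [[A, B], [0, C]]`, where `[[A, B], [0, C]]` is `(u, w) ↦ (A u, B u + C w)`.
[folklore; E3PAGE-t26g13 §1 (vi) «FAST PATH», checked there against explicit kernels] -/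
theorem finrank_range_kerInduced_add_eq_finrank_range_block [FiniteDimensional K U] [FiniteDimensional K W]
    (A : U →ₗ[K] X) (B : U →ₗ[K] Y) (C : W →ₗ[K] Y) :
    finrank K (range ((range C).mkQ.comp (B.domRestrict (ker A)))) + finrank K (range A) + finrank K (range C)
      = finrank K (range ((A.comp (LinearMap.fst K U W)).prod
          (B.comp (LinearMap.fst K U W) + C.comp (LinearMap.snd K U W)))) := by
  -- the block map and membership in its kernel
  set M : (U × W) →ₗ[K] (X × Y) :=
    (A.comp (LinearMap.fst K U W)).prod (B.comp (LinearMap.fst K U W) + C.comp (LinearMap.snd K U W)) with hMdef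
  set ι : (ker A) →ₗ[K] (Y ⧸ range C) := (range C).mkQ.comp (B.domRestrict (ker A)) with hιdef
  have hMapply : ∀ p : U × W, M p = (A p.1, B p.1 + C p.2) := fun p => rfl
  have hιapply : ∀ u : ker A, ι u = (range C).mkQ (B u) := fun u => rfl
  have hmemM : ∀ p : U × W, p ∈ ker M ↔ A p.1 = 0 ∧ B p.1 + C p.2 = 0 := by
    intro p; rw [mem_ker, hMapply, Prod.mk_eq_zero]
  -- the projection φ : ker M → ker A
  let φ : ker M →ₗ[K] ker A :=
    LinearMap.codRestrict (ker A) ((LinearMap.fst K U W).comp (ker M).subtype) (by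
      intro p
      have hp := (hmemM p.1).1 p.2
      simpa [mem_ker] using hp.1)
  have hφapply : ∀ p : ker M, (φ p : U) = p.1.1 := fun p => rfl
  -- the inclusion ψ : ker C → ker M, w ↦ (0, w)
  let ψ : ker C →ₗ[K] ker M :=
    LinearMap.codRestrict (ker M) ((LinearMap.inr K U W).comp (ker C).subtype) (by
      intro w
      rw [hmemM]
      have hw : C (w : W) = 0 := (mem_ker).1 w.2
      simp [hw])
  have hψapply : ∀ w : ker C, (ψ w : U × W) = (0, (w : W)) := fun w => rfl
  have hψinj : Function.Injective ψ := by
    intro w w' h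
    have h' := congrArg (fun p : ker M => (p : U × W).2) h
    simp only [hψapply] at h'
    exact Subtype.ext h'
  -- range ψ = ker φ
  have hψφ : range ψ = ker φ := by
    ext p
    constructor
    · rintro ⟨w, rfl⟩
      rw [mem_ker]
      apply Subtype.ext
      rw [hφapply, hψapply]
      rfl
    · intro hp
      have hu : p.1.1 = 0 := by
        have := congrArg (fun u : ker A => (u : U)) ((mem_ker).1 hp)
        rw [hφapply] at this
        simpa using this
      have hpk := (hmemM p.1).1 p.2
      have hw : C p.1.2 = 0 := by
        have h2 := hpk.2
        rw [hu, map_zero, zero_add] at h2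
        exact h2
      refine ⟨⟨p.1.2, (mem_ker).2 hw⟩, ?_⟩
      apply Subtype.ext
      rw [hψapply]
      ext <;> simp [hu]
  -- range φ = ker ι
  have hφι : range φ = ker ι := by
    ext u
    constructor
    · rintro ⟨p, rfl⟩
      have hpk := (hmemM p.1).1 p.2
      rw [mem_ker, hιapply, Submodule.mkQ_apply, Submodule.Quotient.mk_eq_zero, mem_range]
      refine ⟨-p.1.2, ?_⟩
      have h2 := hpk.2
      rw [map_neg, hφapply]
      rw [← eq_neg_iff_add_eq_zero] at h2
      rw [h2]
    · intro hu
      rw [mem_ker, hιapply, Submodule.mkQ_apply, Submodule.Quotient.mk_eq_zero, mem_range] at hu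
      obtain ⟨w, hw⟩ := hu
      have hmem : ((u : U), -w) ∈ ker M := by
        rw [hmemM]
        refine ⟨(mem_ker).1 u.2, ?_⟩
        simp [hw]
      refine ⟨⟨((u : U), -w), hmem⟩, ?_⟩
      apply Subtype.ext
      rw [hφapply]
  -- five rank–nullity identities and the two identifications
  have hM := M.finrank_range_add_finrank_ker
  have hA := A.finrank_range_add_finrank_ker
  have hC := C.finrank_range_add_finrank_ker
  have hφ := φ.finrank_range_add_finrank_ker
  have hι := ι.finrank_range_add_finrank_ker
  have hUW : finrank K (U × W) = finrank K U + finrank K W := Module.finrank_prod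
  have h6 : finrank K (range φ) = finrank K (ker ι) := by rw [hφι]
  have h7 : finrank K (ker φ) = finrank K (ker C) := by
    rw [← hψφ, LinearMap.finrank_range_of_inj hψinj]
  omega


/-- **The block-rank formula of the third differential (E₄ page).** Maps `A : V₁ → W₁`, `B : V₁ → W₂`,
`G : V₁ → W₃`, `A' : V₂ → W₂`, `B' : V₂ → W₃`, `A'' : V₃ → W₃` over a division ring (`V₁, V₂, V₃`
finite-dimensional); `M₂ = [[A, B], [0, A']]`, `M₂' = [[A', B'], [0, A'']]`, `N = [[A, B, G], [0, A', B'], [0, 0, A'']]`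
(acting on row vectors as `(x, y) ↦ (A x, B x + A' y)` etc.). Let `d : ker M₂ → W₃ ⧸ (range A'' + B'(ker A'))`,
`(x, y) ↦ [G x + B' y]` (for a weight-filtered complex `D = D₀ + D₁ + D₂ + …` with `A, A', A'' = D₀`, `B, B' = D₁`,
`G = D₂` on three consecutive weights this is the differential `d₃` of the spectral sequence read on representatives,
KAPPA-RANDC-E4-t26g14 §4). Then `rank d + rank M₂ + rank M₂' = rank N + rank A'`; no relation among the six maps is
used. [own derivation, t-26 g14 §4 («rank d₃ = rk M₃ − rk M₂(q) − rk M₂(q−1) + rk D₀|_{q−1}»), there unit-tested on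
random filtered complexes; here a theorem] -/
theorem finrank_range_kerPairInduced_add_eq [FiniteDimensional K U] [FiniteDimensional K W]
    {V₃ W₃ : Type*} [AddCommGroup V₃] [Module K V₃] [AddCommGroup W₃] [Module K W₃] [FiniteDimensional K V₃]
    (A : U →ₗ[K] X) (B : U →ₗ[K] Y) (G : U →ₗ[K] W₃) (A' : W →ₗ[K] Y) (B' : W →ₗ[K] W₃) (A'' : V₃ →ₗ[K] W₃) :
    finrank K (range ((range A'' ⊔ (ker A').map B').mkQ.comp
        ((G.comp (LinearMap.fst K U W) + B'.comp (LinearMap.snd K U W)).comp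
          (ker ((A.comp (LinearMap.fst K U W)).prod
            (B.comp (LinearMap.fst K U W) + A'.comp (LinearMap.snd K U W)))).subtype)))
      + finrank K (range ((A.comp (LinearMap.fst K U W)).prod
            (B.comp (LinearMap.fst K U W) + A'.comp (LinearMap.snd K U W))))
      + finrank K (range ((A'.comp (LinearMap.fst K W V₃)).prod
            (B'.comp (LinearMap.fst K W V₃) + A''.comp (LinearMap.snd K W V₃))))
      = finrank K (range ((A.comp (LinearMap.fst K U (W × V₃))).prod
            ((B.comp (LinearMap.fst K U (W × V₃))
                + A'.comp ((LinearMap.fst K W V₃).comp (LinearMap.snd K U (W × V₃)))).prod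
              (G.comp (LinearMap.fst K U (W × V₃))
                + B'.comp ((LinearMap.fst K W V₃).comp (LinearMap.snd K U (W × V₃)))
                + A''.comp ((LinearMap.snd K W V₃).comp (LinearMap.snd K U (W × V₃)))))))
        + finrank K (range A') := by
  -- names
  set M₂ : (U × W) →ₗ[K] (X × Y) :=
    (A.comp (LinearMap.fst K U W)).prod (B.comp (LinearMap.fst K U W) + A'.comp (LinearMap.snd K U W)) with hM₂
  set M₂' : (W × V₃) →ₗ[K] (Y × W₃) :=
    (A'.comp (LinearMap.fst K W V₃)).prod (B'.comp (LinearMap.fst K W V₃) + A''.comp (LinearMap.snd K W V₃))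
    with hM₂'
  set N : (U × (W × V₃)) →ₗ[K] (X × (Y × W₃)) :=
    (A.comp (LinearMap.fst K U (W × V₃))).prod
      ((B.comp (LinearMap.fst K U (W × V₃)) + A'.comp ((LinearMap.fst K W V₃).comp (LinearMap.snd K U (W × V₃)))).prod
        (G.comp (LinearMap.fst K U (W × V₃)) + B'.comp ((LinearMap.fst K W V₃).comp (LinearMap.snd K U (W × V₃)))
          + A''.comp ((LinearMap.snd K W V₃).comp (LinearMap.snd K U (W × V₃))))) with hN
  set S : Submodule K W₃ := range A'' ⊔ (ker A').map B' with hS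
  set gb : (U × W) →ₗ[K] W₃ := G.comp (LinearMap.fst K U W) + B'.comp (LinearMap.snd K U W) with hgb
  set d : ker M₂ →ₗ[K] (W₃ ⧸ S) := S.mkQ.comp (gb.comp (ker M₂).subtype) with hd
  have hM₂apply : ∀ p : U × W, M₂ p = (A p.1, B p.1 + A' p.2) := fun p => rfl
  have hNapply : ∀ p : U × (W × V₃), N p = (A p.1, (B p.1 + A' p.2.1, G p.1 + B' p.2.1 + A'' p.2.2)) :=
    fun p => rfl
  have hgb : ∀ p : U × W, gb p = G p.1 + B' p.2 := fun p => rfl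
  have hdapply : ∀ p : ker M₂, d p = S.mkQ (G p.1.1 + B' p.1.2) := fun p => rfl
  have hmemM₂ : ∀ p : U × W, p ∈ ker M₂ ↔ A p.1 = 0 ∧ B p.1 + A' p.2 = 0 := by
    intro p; rw [mem_ker, hM₂apply, Prod.mk_eq_zero]
  have hmemN : ∀ p : U × (W × V₃),
      p ∈ ker N ↔ A p.1 = 0 ∧ B p.1 + A' p.2.1 = 0 ∧ G p.1 + B' p.2.1 + A'' p.2.2 = 0 := by
    intro p; rw [mem_ker, hNapply, Prod.mk_eq_zero, Prod.mk_eq_zero]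
  -- d₀ : ker M₂ → W₃ ⧸ range A'' and ι' : ker A' → W₃ ⧸ range A''
  let d₀ : ker M₂ →ₗ[K] (W₃ ⧸ range A'') := (range A'').mkQ.comp (gb.comp (ker M₂).subtype)
  have hd₀apply : ∀ p : ker M₂, d₀ p = (range A'').mkQ (G p.1.1 + B' p.1.2) := fun p => rfl
  let ι' : ker A' →ₗ[K] (W₃ ⧸ range A'') := (range A'').mkQ.comp (B'.domRestrict (ker A'))
  have hι'apply : ∀ y : ker A', ι' y = (range A'').mkQ (B' y) := fun y => rfl
  -- π : ker N → ker M₂, (x,y,z) ↦ (x,y)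
  let π₀ : (U × (W × V₃)) →ₗ[K] (U × W) :=
    (LinearMap.fst K U (W × V₃)).prod ((LinearMap.fst K W V₃).comp (LinearMap.snd K U (W × V₃)))
  have hπ₀ : ∀ p : U × (W × V₃), π₀ p = (p.1, p.2.1) := fun p => rfl
  let π : ker N →ₗ[K] ker M₂ :=
    LinearMap.codRestrict (ker M₂) (π₀.comp (ker N).subtype) (by
      intro p
      have hp := (hmemN p.1).1 p.2
      rw [hmemM₂]
      exact ⟨hp.1, hp.2.1⟩)
  have hπapply : ∀ p : ker N, (π p : U × W) = (p.1.1, p.1.2.1) := fun p => rfl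
  -- ρ : ker A'' → ker N, z ↦ (0,0,z)
  let ρ : ker A'' →ₗ[K] ker N :=
    LinearMap.codRestrict (ker N) (((LinearMap.inr K U (W × V₃)).comp (LinearMap.inr K W V₃)).comp
      (ker A'').subtype) (by
      intro z
      rw [hmemN]
      have hz : A'' (z : V₃) = 0 := (mem_ker).1 z.2
      simp [hz])
  have hρapply : ∀ z : ker A'', (ρ z : U × (W × V₃)) = (0, (0, (z : V₃))) := fun z => rfl
  have hρinj : Function.Injective ρ := by
    intro z z' h
    have h' := congrArg (fun p : ker N => (p : U × (W × V₃)).2.2) h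
    simp only [hρapply] at h'
    exact Subtype.ext h'
  -- σ : ker A' → ker M₂, y ↦ (0,y)
  let σ : ker A' →ₗ[K] ker M₂ :=
    LinearMap.codRestrict (ker M₂) ((LinearMap.inr K U W).comp (ker A').subtype) (by
      intro y
      rw [hmemM₂]
      have hy : A' (y : W) = 0 := (mem_ker).1 y.2
      simp [hy])
  have hσapply : ∀ y : ker A', (σ y : U × W) = (0, (y : W)) := fun y => rfl
  have hσinj : Function.Injective σ := by
    intro y y' h
    have h' := congrArg (fun p : ker M₂ => (p : U × W).2) h
    simp only [hσapply] at h'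
    exact Subtype.ext h'
  -- (1) range ρ = ker π
  have hρπ : range ρ = ker π := by
    ext p
    constructor
    · rintro ⟨z, rfl⟩
      rw [mem_ker]
      apply Subtype.ext
      rw [hπapply, hρapply]
      rfl
    · intro hp
      have h0 := congrArg (fun u : ker M₂ => (u : U × W)) ((mem_ker).1 hp)
      rw [hπapply] at h0
      simp only [ZeroMemClass.coe_zero, Prod.mk_eq_zero] at h0
      have hpk := (hmemN p.1).1 p.2
      have hz : A'' p.1.2.2 = 0 := by
        have h3 := hpk.2.2
        rw [h0.1, h0.2, map_zero, map_zero, zero_add, zero_add] at h3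
        exact h3
      refine ⟨⟨p.1.2.2, (mem_ker).2 hz⟩, ?_⟩
      apply Subtype.ext
      rw [hρapply]
      ext <;> simp [h0.1, h0.2]
  -- (2) range π = ker d₀
  have hπd₀ : range π = ker d₀ := by
    ext u
    constructor
    · rintro ⟨p, rfl⟩
      have hpk := (hmemN p.1).1 p.2
      rw [mem_ker, hd₀apply, Submodule.mkQ_apply, Submodule.Quotient.mk_eq_zero, mem_range]
      refine ⟨-p.1.2.2, ?_⟩
      have h3 := hpk.2.2
      rw [hπapply]
      rw [← eq_neg_iff_add_eq_zero] at h3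
      rw [map_neg, ← h3]
    · intro hu
      rw [mem_ker, hd₀apply, Submodule.mkQ_apply, Submodule.Quotient.mk_eq_zero, mem_range] at hu
      obtain ⟨z, hz⟩ := hu
      have hupk := (hmemM₂ u.1).1 u.2
      have hmem : (u.1.1, (u.1.2, -z)) ∈ ker N := by
        rw [hmemN]
        refine ⟨hupk.1, hupk.2, ?_⟩
        simp [hz]
      refine ⟨⟨(u.1.1, (u.1.2, -z)), hmem⟩, ?_⟩
      apply Subtype.ext
      rw [hπapply]
  -- (3) ker d = ker d₀ ⊔ range σ
  have hkd : ker d = ker d₀ ⊔ range σ := by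
    apply le_antisymm
    · intro p hp
      rw [mem_ker, hdapply, Submodule.mkQ_apply, Submodule.Quotient.mk_eq_zero, hS, Submodule.mem_sup] at hp
      obtain ⟨a, ha, b, hb, hab⟩ := hp
      rw [mem_range] at ha
      obtain ⟨z, rfl⟩ := ha
      rw [Submodule.mem_map] at hb
      obtain ⟨y₀, hy₀, rfl⟩ := hb
      have hy₀' : A' y₀ = 0 := (mem_ker).1 hy₀
      have hppk := (hmemM₂ p.1).1 p.2
      have hmem1 : (p.1.1, p.1.2 - y₀) ∈ ker M₂ := by
        rw [hmemM₂]
        refine ⟨hppk.1, ?_⟩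
        rw [map_sub, hy₀', sub_zero]
        exact hppk.2
      have hsplit : p = ⟨(p.1.1, p.1.2 - y₀), hmem1⟩ + σ ⟨y₀, hy₀⟩ := by
        apply Subtype.ext
        rw [Submodule.coe_add, hσapply]
        ext <;> simp
      rw [hsplit]
      apply Submodule.add_mem_sup
      · rw [mem_ker, hd₀apply, Submodule.mkQ_apply, Submodule.Quotient.mk_eq_zero, mem_range]
        refine ⟨z, ?_⟩
        have h' := eq_sub_of_add_eq hab
        rw [h', map_sub, add_sub_assoc]
      · exact mem_range_self σ _
    · apply sup_le
      · intro p hp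
        rw [mem_ker, hd₀apply, Submodule.mkQ_apply, Submodule.Quotient.mk_eq_zero] at hp
        rw [mem_ker, hdapply, Submodule.mkQ_apply, Submodule.Quotient.mk_eq_zero, hS]
        exact Submodule.mem_sup_left hp
      · rintro p ⟨y, rfl⟩
        rw [mem_ker, hdapply, Submodule.mkQ_apply, Submodule.Quotient.mk_eq_zero, hS, hσapply]
        apply Submodule.mem_sup_right
        rw [Submodule.mem_map]
        refine ⟨y, y.2, ?_⟩
        simp
  -- (4) ker d₀ ⊓ range σ = (ker ι').map σ
  have hinf : ker d₀ ⊓ range σ = (ker ι').map σ := by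
    apply le_antisymm
    · rintro p ⟨hp1, hp2⟩
      obtain ⟨y, rfl⟩ := hp2
      rw [Submodule.mem_map]
      refine ⟨y, ?_, rfl⟩
      rw [SetLike.mem_coe, mem_ker, hd₀apply, hσapply] at hp1
      rw [mem_ker, hι'apply]
      simpa using hp1
    · intro p hp
      rw [Submodule.mem_map] at hp
      obtain ⟨y, hy, rfl⟩ := hp
      refine ⟨?_, mem_range_self σ y⟩
      rw [mem_ker, hι'apply] at hy
      rw [SetLike.mem_coe, mem_ker, hd₀apply, hσapply]
      simpa using hy
  -- dimension bookkeeping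
  have hN := N.finrank_range_add_finrank_ker
  have hM := M₂.finrank_range_add_finrank_ker
  have hM' := M₂'.finrank_range_add_finrank_ker
  have hA' := A'.finrank_range_add_finrank_ker
  have hA'' := A''.finrank_range_add_finrank_ker
  have hπrn := π.finrank_range_add_finrank_ker
  have hdrn := d.finrank_range_add_finrank_ker
  have hι'rn := ι'.finrank_range_add_finrank_ker
  have h1 : finrank K (ker π) = finrank K (ker A'') := by
    rw [← hρπ, LinearMap.finrank_range_of_inj hρinj]
  have h2 : finrank K (range π) = finrank K (ker d₀) := by rw [hπd₀]
  have h3 := Submodule.finrank_sup_add_finrank_inf_eq (ker d₀) (range σ)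
  rw [← hkd, hinf] at h3
  have h4 : finrank K (range σ) = finrank K (ker A') := LinearMap.finrank_range_of_inj hσinj
  have h5 : finrank K ((ker ι').map σ) = finrank K (ker ι') :=
    ((Submodule.equivMapOfInjective σ hσinj (ker ι')).finrank_eq).symm
  -- theorem 1 for (A', B', A''):  rank ι' + rank A' + rank A'' = rank M₂'
  have h6 : finrank K (range ι') + finrank K (range A') + finrank K (range A'') = finrank K (range M₂') :=
    finrank_range_kerInduced_add_eq_finrank_range_block A' B' A''
  have hUW : finrank K (U × W) = finrank K U + finrank K W := Module.finrank_prod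
  have hWV : finrank K (W × V₃) = finrank K W + finrank K V₃ := Module.finrank_prod
  have hUWV : finrank K (U × (W × V₃)) = finrank K U + (finrank K W + finrank K V₃) := by
    rw [Module.finrank_prod, Module.finrank_prod]
  omega

end Summit.Ventures.HSemireg
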